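import Summits.Ventures.PercRepro.S1ChainCells
import Summits.Ventures.PercRepro.S1KillCellTenFive
import Summits.Ventures.PercRepro.S1SeriesLever

/-!
# PercRepro — THE CELL `(10, 6)` OF THE `q = 4` WINDOW BY THE CHAIN LEVERS (p2, gen 23; SUBCLAIM-S1 §6.8)

The cell `(10, 6)` (`16` points; `1.1335` in the caps-only form, short by `39` at `t = 7` and `1801` at `t = 8`
under the kill and nullity levers of gen 22): the coloop-free case at the actual triangle count `t = s₃ ≤ 8` on the
lever caps `(t, 30, 170)` by the chain dichotomy with `r = 1, 1, 3, 3, 4, 5, 5, 5` — the early stop has nullity `≥ r`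
from the restriction cap `cq3` (`cq3 4 = 5 < 6 ≤ t` forces `r = 5` at `t ≥ 6`), the chain of `r` triangles with
union `u` carries `≥ u − 2r` pairwise disjoint triangles whose kill overlaps in `C(10, 4) = 210` rather than
`C(11, 5) = 462` `10`-sets, and the exclusion at `k = 7 − r` points outside the union; the last open line
(`t = 8`, `u = 14`, two points outside) closes by the refined dependent count with margin `≈ 316` against `7`.
One coloop (`p = 9` on `15` points, caps `8 / 32 / 175`) likewise; two coloops (`p = 8` on `14`, `8 / 35 / 182`)
with `r = 1`; `c ≥ 3` lossy. Exact-integer twin mining/p2/g23/lines106.py.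

* `gb_cap_six` — the series-class cap `gb 6 n` instantiated; `rrTenSix0`, `rrTenSix1`, `rrTenSix2` — the chain lengths per `t`;
* **`c025_core_ten_six`**.
Axioms: standard.
-/

open scoped Matroid

namespace PercRepro

namespace S1

open Set

variable {α : Type}

/-- **The series-class cap at `(10, 16)`, `(9, 15)`, `(8, 14)`** (nullity `6`): `s₄ ≤ gb 6 n` on the coloop-free part. -/
theorem gb_cap_six (p n S : ℕ) (hn : n = p + 6) (hv : gb 6 n = S) : ∀ (N : Matroid α) [N.Finite],
    (∀ e ∈ N.E, ∃ A ⊆ N.E \ {e}, e ∉ N.closure A ∧ e ∉ N.closure ((N.E \ {e}) \ A)) →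
    N.E.encard = N.eRank + ((6 : ℕ) : ℕ∞) → N.E.ncard = p + 6 → N.coloops = ∅ →
    {C : Set α | N.IsCircuit C ∧ C.ncard = 4}.ncard ≤ S := by
  intro N _ hfree hd hn' hcol
  have h := ncard_fourCircuits_le_gb_of_coloopFree N hfree hd hcol hn'
  rwa [← hn, hv] at h

/-- The chain length `r` at each `t = s₃` (coloop-free case). -/
def rrTenSix0 (t : ℕ) : ℕ := [0, 1, 1, 3, 3, 4, 5, 5, 5].getD t 0

/-- The chain length `r` at each `t` (one coloop). -/
def rrTenSix1 (t : ℕ) : ℕ := [0, 1, 1, 3, 1, 4, 5, 5, 5].getD t 0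

/-- The chain length `r` at each `t` (two coloops). -/
def rrTenSix2 (t : ℕ) : ℕ := [0, 1, 1, 1, 1, 1, 1, 1, 1].getD t 0

/-- **THE CELL `(10, 6)`**: an `e`-free core of rank `10` with `16` points satisfies `RLS` at level `4`. -/
theorem c025_core_ten_six (M : Matroid α) [M.Finite] (hR : M.eRank = (10 : ℕ)) (hn : M.E.ncard = 16)
    (hfree : ∀ e ∈ M.E, ∃ A ⊆ M.E \ {e}, e ∉ M.closure A ∧ e ∉ M.closure ((M.E \ {e}) \ A)) :
    ThmN.RLS M 10 4 := by
  rcases (show M.coloops.ncard = 0 ∨ M.coloops.ncard = 1 ∨ M.coloops.ncard = 2 ∨ 3 ≤ M.coloops.ncard by omega)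
    with h | h | h | h
  · exact rls_of_ladder_case_chain M (p := 10) (c := 0) (d := 6) (by norm_num) (by norm_num) hR hn hfree h
      (by norm_num) (by norm_num) (P := 8) (S := 30) (S5 := 170) (by decide) (gb_cap_six 10 16 30 rfl (by decide))
      (by decide) rrTenSix0 (by decide) (by decide +kernel) (by decide +kernel) (by decide +kernel)
  · exact rls_of_ladder_case_chain M (p := 9) (c := 1) (d := 6) (by norm_num) (by norm_num) hR hn hfree h
      (by norm_num) (by norm_num) (P := 8) (S := 32) (S5 := 175) (by decide) (gb_cap_six 9 15 32 rfl (by decide))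
      (by decide) rrTenSix1 (by decide) (by decide +kernel) (by decide +kernel) (by decide +kernel)
  · exact rls_of_ladder_case_chain M (p := 8) (c := 2) (d := 6) (by norm_num) (by norm_num) hR hn hfree h
      (by norm_num) (by norm_num) (P := 8) (S := 35) (S5 := 182) (by decide) (gb_cap_six 8 14 35 rfl (by decide))
      (by decide) rrTenSix2 (by decide) (by decide +kernel) (by decide +kernel) (by decide +kernel)
  · exact rls_of_coloops_lossy M (p := 7) (c := 3) (hR.trans (by norm_num)) (by norm_num) h phiK_ten_four_le

end S1

end PercRepro
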